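import Mathlib
import Literature.Computability.Complexity.CliqueTestGraphs
import Summits.PneNP.PneNP.Theorems.ConvexRankGatesConvexGateBlindJuntaHard
import Summits.PneNP.PneNP.Theorems.ConvexRankGatesConvexGateBlindSharpJunta

/-!
# PneNP / ConvexRankGates — `ConvexGateBlind`: the junta-restricted canonical form holds up to the SHARP locality `k - 1`

Helpers (`--supports stmt-PneNP-10680`). `…JuntaHard.lean` (`junta_crux`) with the sharp junta theorem of `…SharpJunta.lean`
plugged in: for EVERY `δ ∈ (0,1/2)`, eventually in `m`, for every `ε > 0`, the canonical identity
`cdist Q u - ε = tr(H_u Y(Q ∩ S₀)) + ∑_l W_{u,l} G_l(Q ∩ S_l)` (`H_u, Y ⪰ 0`, `W, G ≥ 0`, any `q`, any number of terms) fails as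
soon as the row objects read at most `k - 1` vertices (`#S₀, #S_l ≤ k - 1`, `k = ⌈m^δ⌉₊`) — was `2 #S ≤ k - 1`. Since row objects
reading `k` vertices (atoms) trivially suffice, the locality threshold of the crux's canonical form is exactly `k`
(`junta_cliqueDistConeRankHard_sharp`, registered stub `junta_crux_sharp`). [new]
-/

set_option linter.dupNamespace false

namespace Summit.PneNP.PneNP.Theorems

open Finset Filter Literature.Computability.Complexity
open Summit.PneNP.PneNP.Cruxes.ConvexGateBlind.StrictRankConicCover (Edge cdist padRow padCol liveEmb apexSet
  cdist_pad cliqueFn_padCol card_padRow)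

noncomputable section

/-- **The junta-restricted crux is true (every `δ ∈ (0,1/2)`).** Eventually in `m`, for every `ε > 0`, every PSD-valued
`Y` and `H`, every `W, G ≥ 0` and all junta sets with `#S₀ ≤ k - 1`, `#S_l ≤ k - 1` (`k = ⌈m^δ⌉₊`) — the SHARP locality, the canonical
identity `cdist Q u - ε = tr(H_u Y(Q ∩ S₀)) + ∑_l W_{u,l} G_l(Q ∩ S_l)` fails for some `k`-set `Q` and some `k`-clique-free
`u` — with no bound on the PSD dimension `q` or on the number of terms. [new] -/
theorem junta_cliqueDistConeRankHard_sharp {δ : ℝ} (hδ0 : 0 < δ) (hδ : δ < 1 / 2) :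
    ∀ᶠ m : ℕ in atTop, ∀ ε : ℝ, 0 < ε → ∀ (q : ℕ) (ι : Type) [Fintype ι] (S₀ : Finset (Fin m))
      (S : ι → Finset (Fin m)), S₀.card ≤ ⌈(m : ℝ) ^ δ⌉₊ - 1 → (∀ l, (S l).card ≤ ⌈(m : ℝ) ^ δ⌉₊ - 1) →
      ∀ (H : (Edge m → Bool) → Matrix (Fin q) (Fin q) ℝ) (Y : Finset (Fin m) → Matrix (Fin q) (Fin q) ℝ)
        (W : (Edge m → Bool) → ι → ℝ) (G : ι → Finset (Fin m) → ℝ),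
      (∀ u, cliqueFn m ⌈(m : ℝ) ^ δ⌉₊ u = false → (H u).PosSemidef) → (∀ P, (Y P).PosSemidef) →
      (∀ u l, 0 ≤ W u l) → (∀ l P, 0 ≤ G l P) →
      ¬ ∀ (Q : Finset (Fin m)) (u : Edge m → Bool), Q.card = ⌈(m : ℝ) ^ δ⌉₊ → cliqueFn m ⌈(m : ℝ) ^ δ⌉₊ u = false →
          cdist Q u - ε = (H u * Y (Q ∩ S₀)).trace + ∑ l, W u l * G l (Q ∩ S l) := by
  filter_upwards [eventually_ceil_rpow_sq_le hδ0 hδ] with m hm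
  obtain ⟨hk3, hkk⟩ := hm
  intro ε hε q ι _ S₀ S hS₀ hS H Y W G hH hY hW hG hall
  classical
  -- sizes: `k = K + 1`, classes of size `n = m / K ≥ k`, block `M = K n ≤ m`
  set k : ℕ := ⌈(m : ℝ) ^ δ⌉₊ with hk
  set K : ℕ := k - 1 with hK
  have hkK : k = K + 1 := by omega
  have hK2 : 2 ≤ K := by omega
  set n : ℕ := m / K with hn
  have hKpos : 0 < K := by omega
  have hnk : K + 1 ≤ n := by
    rw [hn, Nat.le_div_iff_mul_le hKpos]
    calc (K + 1) * K ≤ k * k := by rw [hkK]; exact Nat.mul_le_mul_left _ (Nat.le_succ K)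
      _ ≤ m := hkk
  set M : ℕ := K * n with hM
  have hpad : M + 0 ≤ m := by rw [add_zero, hM, hn, mul_comm]; exact Nat.div_mul_le_self m K
  -- the coloured block and its column
  set hb : Fin M → Fin K := balCol K n with hhb
  have hbal : ∀ c, (cls hb c).card = n := card_cls_balCol K n
  set u₀ : Edge m → Bool := padCol (m := m) 0 (colorVec hb) with hu₀
  have hu₀free : cliqueFn m k u₀ = false := by
    have := cliqueFn_padCol hpad (K := K + 1) (by omega) (colorVec hb) (cliqueFn_colorVec hb (Nat.lt_succ_self K))
    rw [hkK]
    simpa using this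
  -- the identity restricted to the block is a junta representation of `cdist · (colorVec hb) - ε`
  let Sx : Option ι → Finset (Fin M) := fun o =>
    o.elim (univ.filter fun v => liveEmb hpad v ∈ S₀) (fun l => univ.filter fun v => liveEmb hpad v ∈ S l)
  let Fx : Option ι → Finset (Fin M) → ℝ := fun o P' =>
    o.elim ((H u₀ * Y (P'.map (liveEmb hpad))).trace) (fun l => W u₀ l * G l (P'.map (liveEmb hpad)))
  have hrep : ∀ Q' : Finset (Fin M), Q'.card = K + 1 → cdist Q' (colorVec hb) - ε = ∑ o, Fx o (Q' ∩ Sx o) := by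
    intro Q' hQ'
    have hQ : (padRow hpad Q').card = k := by rw [card_padRow, hQ', hkK]
    have h1 := hall (padRow hpad Q') u₀ hQ hu₀free
    rw [hu₀, cdist_pad hpad Q' (colorVec hb)] at h1
    rw [← hu₀] at h1
    rw [h1, Fintype.sum_option]
    simp only [Fx, Sx, Option.elim]
    rw [padRow_zero hpad, map_liveEmb_inter hpad Q' S₀]
    congr 1
    refine Finset.sum_congr rfl fun l _ => ?_
    rw [map_liveEmb_inter hpad Q' (S l)]
  refine cdist_colorVec_not_juntaRep_sharp hb (t := K) hbal hK2 hnk le_rfl hε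
    (ι := Option ι) Sx Fx ?_ ?_ hrep
  · intro o
    cases o with
    | none =>
      show (univ.filter fun v => liveEmb hpad v ∈ S₀).card ≤ K
      have := card_filter_liveEmb_mem_le hpad S₀
      omega
    | some l =>
      show (univ.filter fun v => liveEmb hpad v ∈ S l).card ≤ K
      have := card_filter_liveEmb_mem_le hpad (S l)
      have h2 := hS l
      omega
  · intro o P'
    cases o with
    | none => exact Literature.Combinatorics.SimpleGraph.trace_mul_nonneg_of_posSemidef (hH u₀ hu₀free) (hY _)
    | some l => exact mul_nonneg (hW u₀ l) (hG l _)

/-- **Registered helper stub (the junta-restricted crux holds up to locality `k - 1`).** Restatement of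
`junta_cliqueDistConeRankHard_sharp` with all parameters explicit. -/
theorem junta_crux_sharp : ∀ (δ : ℝ), 0 < δ → δ < 1 / 2 → ∀ᶠ m : ℕ in Filter.atTop, ∀ ε : ℝ, 0 < ε → ∀ (q : ℕ) (ι : Type) [Fintype ι] (S₀ : Finset (Fin m)) (S : ι → Finset (Fin m)), S₀.card ≤ ⌈(m : ℝ) ^ δ⌉₊ - 1 → (∀ l, (S l).card ≤ ⌈(m : ℝ) ^ δ⌉₊ - 1) → ∀ (H : (Edge m → Bool) → Matrix (Fin q) (Fin q) ℝ) (Y : Finset (Fin m) → Matrix (Fin q) (Fin q) ℝ) (W : (Edge m → Bool) → ι → ℝ) (G : ι → Finset (Fin m) → ℝ), (∀ u, cliqueFn m ⌈(m : ℝ) ^ δ⌉₊ u = false → (H u).PosSemidef) → (∀ P, (Y P).PosSemidef) → (∀ u l, 0 ≤ W u l) → (∀ l P, 0 ≤ G l P) → ¬ ∀ (Q : Finset (Fin m)) (u : Edge m → Bool), Q.card = ⌈(m : ℝ) ^ δ⌉₊ → cliqueFn m ⌈(m : ℝ) ^ δ⌉₊ u = false → cdist Q u - ε = (H u * Y (Q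 ∩ S₀)).trace + ∑ l, W u l * G l (Q ∩ S l) := by
  intro δ hδ0 hδ
  exact junta_cliqueDistConeRankHard_sharp hδ0 hδ

end

end Summit.PneNP.PneNP.Theorems
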